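import Literature.Probability.LatticeModels.SahiThirdOrderCorrelation
import Summits.CriticalPhenomena.PercolationContinuityZ3.Theorems.PercNearOneGluingNoHeavyLowerTailSahiE3CovarianceForm
import HarnessLib

/-!
# `NoHeavyLowerTail` (stmt-CriticalPhenomena-4575) — Sahi's `E₃`: the proved case
# "one event contains the other two"

Support file (new-inequality factory seat `prim-ineq-gen-4`, gen 6; `--supports stmt-CriticalPhenomena-4575`).  No definitions,
no named facts, no sorries.  Companion of `Literature.Probability.LatticeModels.SahiThirdOrderCorrelation` (nested pair
`sahiE3_nonneg_of_subset`) and of the memo run/shared/lean/prim/prim-ineq-gen-4/FINDING-NOGO-INSTANCE-BLIND-g6.md §1 (I2).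

For three events `A, B, C` under a measure `μ`, Sahi's third functional
`E₃(A,B,C) = 2μ(ABC) + μAμBμC − (μA·μ(BC) + μB·μ(AC) + μC·μ(AB))` has the COVARIANCE FORM
  `E₃(A,B,C) = [μ(ABC) − μB·μ(AC)] + [μ(ABC) − μC·μ(AB)] − μA·[μ(BC) − μB·μC]` (already in the tree as
`sahiE3_eq_cov_add_cov_sub_mul_cov`, `…SahiE3CovarianceForm`),
i.e. `Cov(B, A∩C) + Cov(C, A∩B) − μ(A)·Cov(B,C)`: Sahi's conjecture `E₃ ≥ 0` for three increasing events says that the two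
Harris slacks of `B` against `A∩C` and of `C` against `A∩B` pay for `μ(A)` times the Harris slack of `B` against `C`
(for `A = Ω` this is `2Cov(B,C) ≥ Cov(B,C)`).  Consequence proved here: if `A ⊇ B` and `A ⊇ C` then
`E₃(A,B,C) = (2 − μA)·Cov(B,C)` (`sahiE3_eq_of_subset_subset`), hence `E₃ ≥ 0` whenever `B, C` are positively correlated and
`μA ≤ 2` (`sahiE3_nonneg_of_subset_subset`) — in particular for three increasing (resp. three decreasing) events of a product
measure `prodBernoulli p` with `B ∪ C ⊆ A` (`prodBernoulli_sahiE3_nonneg_of_union_subset`, `…_lower`), by Harris.  Together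
with the nested-pair case this settles every instance of Kahn's Conjecture 5 in which one event contains another or contains
the other two; the first open shape is `C ⊆ A ∪ B` (row 1 of the E3GRP list: `D[a₁|a₂a₃] ⊆ D[o|a₁] ∪ D[o|a₂a₃]`).
[cite: Kahn2022, Conj. 5 (arXiv p. 3); LiebSahi2021, eq. (2.1) (arXiv p. 5)]
-/

namespace Summit.CriticalPhenomena.PercolationContinuityZ3.Theorems

open MeasureTheory Literature.Probability.LatticeModels

/-- **One event contains the other two**: if `B ⊆ A` and `C ⊆ A` then `E₃(A,B,C) = (2 − μA)·(μ(B∩C) − μB·μC)`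
(any measure). [this work] -/
theorem sahiE3_eq_of_subset_subset {Ω : Type*} [MeasurableSpace Ω] (μ : Measure Ω) {A B C : Set Ω}
    (hBA : B ⊆ A) (hCA : C ⊆ A) :
    sahiE3 μ A B C = (2 - μ.real A) * (μ.real (B ∩ C) - μ.real B * μ.real C) := by
  rw [sahiE3_def, Set.inter_eq_right.2 hBA, Set.inter_eq_right.2 hCA]
  ring

/-- `E₃(A,B,C) ≥ 0` when `B ∪ C ⊆ A`, `B, C` are positively correlated and `μA ≤ 2` (e.g. any probability measure).
[this work] -/
theorem sahiE3_nonneg_of_subset_subset {Ω : Type*} [MeasurableSpace Ω] (μ : Measure Ω) {A B C : Set Ω}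
    (hBA : B ⊆ A) (hCA : C ⊆ A) (hA : μ.real A ≤ 2) (hBC : μ.real B * μ.real C ≤ μ.real (B ∩ C)) :
    0 ≤ sahiE3 μ A B C := by
  rw [sahiE3_eq_of_subset_subset μ hBA hCA]
  exact mul_nonneg (by linarith) (by linarith)

variable {ι : Type*}

/-- **Kahn's Conjecture 5 when one increasing event contains the other two** (`prodBernoulli p`, any index type):
`0 ≤ E₃(A,B,C)` for up-sets `B, C ⊆ A` — Harris for the pair `B, C`. [this work] -/
theorem prodBernoulli_sahiE3_nonneg_of_union_subset (p : ι → unitInterval) {A B C : Set (Set ι)}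
    (hB : IsUpperSet B) (hC : IsUpperSet C) (hBm : MeasurableSet B) (hCm : MeasurableSet C)
    (hBA : B ⊆ A) (hCA : C ⊆ A) : 0 ≤ sahiE3 (prodBernoulli p) A B C :=
  sahiE3_nonneg_of_subset_subset _ hBA hCA (le_trans measureReal_le_one (by norm_num))
    (prodBernoulli_harris p hB hC hBm hCm)

/-- The same for three DEcreasing events (separations), `B ∪ C ⊆ A`. [this work] -/
theorem prodBernoulli_sahiE3_nonneg_of_union_subset_lower (p : ι → unitInterval) {A B C : Set (Set ι)}
    (hB : IsLowerSet B) (hC : IsLowerSet C) (hBm : MeasurableSet B) (hCm : MeasurableSet C)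
    (hBA : B ⊆ A) (hCA : C ⊆ A) : 0 ≤ sahiE3 (prodBernoulli p) A B C :=
  sahiE3_nonneg_of_subset_subset _ hBA hCA (le_trans measureReal_le_one (by norm_num))
    (prodBernoulli_harris_lower p hB hC hBm hCm)

end Summit.CriticalPhenomena.PercolationContinuityZ3.Theorems
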